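import Summits.HodgeConjecture.HodgeConjecture.Theses.NikulinTwinTransport
import Summits.HodgeConjecture.HodgeConjecture.Theorems.NikulinTwinTransportTwinSimilitudeAlgebraic
import Summits.HodgeConjecture.HodgeConjecture.Theorems.NikulinTwinTransportTwinSimilitudeAlgebraicMarkings
import Summits.HodgeConjecture.HodgeConjecture.Theorems.NikulinTwinTransportSquareTranscendental
import Literature.AlgebraicGeometry.Surfaces.K3Marking
import Literature.AlgebraicGeometry.Surfaces.K3HodgeTypesHolds
import Literature.AlgebraicGeometry.HodgeTheory.HodgeIndexSurface
import Literature.AlgebraicGeometry.HodgeTheory.ComplexGysinCorrespondence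
import HarnessLib

/-!
# Route NikulinTwinTransport · crux `TwinSimilitudeAlgebraic` (stmt-HodgeConjecture-13674) —
# stub `stub_wittCompletion` of line `hyperkaehler-nikulin-anchors` (reshape r1): linear-algebra helpers

Helpers for the Witt completion of a partial twin map (file
`NikulinTwinTransportTwinSimilitudeAlgebraicStubWittCompletion`): the TWO-SPACE forms of the
one-surface lemmas of `NikulinTwinTransportRealMultiplicationCore` /
`NikulinTwinTransportSquareTranscendental`. They are at the same time the formal debt "Witt
cancellation over `ℚ`" + "the `ℚ`-form of `H²` under a marking" named by the route's support item
`RealMultiplicationGlue` (stmt-HodgeConjecture-13681: extend a partial isometry `T(S′)_ℚ → T(S)_ℚ`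
by `NS(S′)_ℚ → NS(S)_ℚ`), in the two-subspace generality that item needs; landed under
`--supports` of that item (the crux stmt-HodgeConjecture-13674 admits only its registered stubs).

* `exists_eq_sum_rankOne₂` — a linear map `g : V → W` with image in `N' ≤ W` killing `N^⊥ ≤ V`
  is `x ↦ Σᵢ B(x, aᵢ) bᵢ` with `aᵢ ∈ N`, `bᵢ ∈ N'`.
* `exists_similitude_completion` — over a field of characteristic `≠ 2`: `(V, B)` symmetric
  non-degenerate with a self-similitude of multiplier `r ≠ 0`, `N, N' ≤ V` non-degenerate
  subspaces with orthogonals `T, T'`, and `F : V → V` with `F(N) ⊆ N'`, `F(T) ⊆ T'`, `F` an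
  `r`-similitude on `T`, and `T' ∩ F(T)^⊥ = 0`; then `F + Σᵢ B(·, aᵢ) bᵢ` is an `r`-similitude of
  `V` for suitable `aᵢ ∈ N`, `bᵢ ∈ N'` (Witt's extension theorem, the tree's PROVED
  `Witt_isometry_extension_holds`, applied to `F|_T`).
* `exists_nsRat` — the rational Néron–Severi points `N_ℚ ≤ Λ_ℚ` of a marked projective K3 surface:
  non-degenerate (Hodge index), with `N_ℚ^⊥` read back as the transcendence condition.
* `map_mem_algebraicClasses_of_hodgeMap` — a rational type-preserving map sends `NS(S)` into
  `NS(Sg)` (Lefschetz `(1,1)` on the target).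
* `isOfHodgeType_add_sum` — `Φ + Σᵢ νᵢ` preserves Hodge types when the `νᵢ` kill the `(2,0)`- and
  `(0,2)`-lines and take values of type `(1,1)`.

Sources: Huybrechts, Comment. Math. Helv. 94 (2019) §1; Varesco, Math. Z. 305 (2023) Thm. 2.1 /
Rem. 2.2; Iversen, *Hyperbolic Geometry* (1992) Ch. I Thm. 2.4. Prover seat
prover-line-stmt-HodgeConjecture-13674-0 (stub worker, stub `stub_wittCompletion`).
-/

noncomputable section

set_option linter.dupNamespace false

open CategoryTheory MonoidalCategory
open scoped Manifold Matrix
open Literature.AlgebraicGeometry.Motives Literature.AlgebraicGeometry.HodgeTheory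
open Literature.AlgebraicGeometry.Surfaces Literature.Geometry.Kaehler
open Literature.AlgebraicTopology.SingularHomology
open Literature.LinearAlgebra.QuadraticForm
open Summit.HodgeConjecture.HodgeConjecture.Theses.NikulinTwinTransport

namespace Summit.HodgeConjecture.HodgeConjecture.Theorems.NikulinTwinTransport

/-! ### Over a field: rank-one expansion with two spaces, and the Witt completion -/

section Field

variable {K : Type*} [Field K] {V : Type*} [AddCommGroup V] [Module K V] [FiniteDimensional K V]
  {W : Type*} [AddCommGroup W] [Module K W]

/-- **A linear map `g : V → W` with image in `N' ≤ W` killing `N^⊥ ≤ V` is a finite sum of rank-one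
maps `x ↦ B(x, aᵢ) bᵢ` with `aᵢ ∈ N`, `bᵢ ∈ N'`** (`B` symmetric non-degenerate on the
finite-dimensional `V`, `N'` finite-dimensional): expand in a basis `(bᵢ)` of `N'`; each coordinate
functional of `g` kills `N^⊥`, hence is `B(·, aᵢ)` with `aᵢ ∈ N^⊥⊥ = N`. Two-space form of
`exists_eq_sum_rankOne`. [folklore] -/
theorem exists_eq_sum_rankOne₂ {B : LinearMap.BilinForm K V} (hB : B.IsSymm) (hBn : B.Nondegenerate)
    (N : Submodule K V) (N' : Submodule K W) [FiniteDimensional K N'] (g : V →ₗ[K] W)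
    (hgN : ∀ x, g x ∈ N') (hgT : ∀ t ∈ B.orthogonal N, g t = 0) :
    ∃ (m : ℕ) (a : Fin m → V) (b : Fin m → W), (∀ i, a i ∈ N) ∧ (∀ i, b i ∈ N') ∧
      ∀ x, g x = ∑ i, B x (a i) • b i := by
  classical
  have hBr : B.IsRefl := hB.isRefl
  let bN := Module.finBasis K N'
  let g' : V →ₗ[K] N' := LinearMap.codRestrict N' g hgN
  let φ : Fin (Module.finrank K N') → Module.Dual K V := fun i => (bN.coord i) ∘ₗ g'
  let a : Fin (Module.finrank K N') → V := fun i => (B.toDual hBn).symm (φ i)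
  have ha : ∀ i x, B (a i) x = φ i x := fun i x =>
    LinearMap.BilinForm.apply_toDual_symm_apply (hB := hBn) (f := φ i) (v := x)
  refine ⟨Module.finrank K N', a, fun i => (bN i : W), fun i => ?_, fun i => (bN i).2, fun x => ?_⟩
  · rw [← LinearMap.BilinForm.orthogonal_orthogonal hBn hBr N, LinearMap.BilinForm.mem_orthogonal_iff]
    intro t ht
    rw [hB.eq, ha, LinearMap.comp_apply]
    have h0 : g' t = 0 := Subtype.ext (by simpa [g'] using hgT t ht)
    rw [h0, map_zero]
  · have hsum := bN.sum_repr (g' x)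
    have hcoe : (g x : W) = ((g' x : N') : W) := rfl
    rw [hcoe, ← hsum, Submodule.coe_sum]
    refine Finset.sum_congr rfl fun i _ => ?_
    rw [Submodule.coe_smul, hB.eq, ha]
    rfl

/-- **Witt completion of a partial similitude.** Let `B` be symmetric non-degenerate on the
finite-dimensional `K`-space `V` (`char K ≠ 2`) with a self-similitude `M` of multiplier `r ≠ 0`;
let `N, N' ≤ V` be subspaces on which `B` is non-degenerate, `T = N^⊥`, `T' = N'^⊥`; and let
`F : V → V` map `N` into `N'` and `T` into `T'`, multiply `B` by `r` on `T`, and satisfy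
`T' ∩ F(T)^⊥ = 0`. Then for suitable `aᵢ ∈ N`, `bᵢ ∈ N'` the map `Ψ = F + Σᵢ B(·, aᵢ) bᵢ`
multiplies `B` by `r` on all of `V`. Proof: `F|_T` is injective (`T ∩ T^⊥ = T ∩ N = 0`), so Witt's extension
theorem along `M : (V, rB) ⥲ (V, B)` gives an `r`-similitude `τ` of `V` with `τ = F` on `T`;
`τ(N) ⊥ τ(T) = F(T)` and `T' ∩ F(T)^⊥ = 0` force `τ(N) ⊆ N'`, so `g = τ − F` kills `T` and maps
`V = N ⊕ T` into `N'`, whence the rank-one expansion. [cite: Iversen1992, Ch. I §2 Thm. 2.4]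
[cite: Huybrechts2019, §1] -/
theorem exists_similitude_completion [NeZero (2 : K)] {B : LinearMap.BilinForm K V}
    (hB : B.IsSymm) (hBn : B.Nondegenerate) {r : K} (hr : r ≠ 0)
    (M : V →ₗ[K] V) (hM : ∀ x y, B (M x) (M y) = r * B x y)
    (N N' : Submodule K V) (hN : (B.restrict N).Nondegenerate) (hN' : (B.restrict N').Nondegenerate)
    (F : V →ₗ[K] V) (hFN : ∀ u ∈ N, F u ∈ N')
    (hFT : ∀ t ∈ B.orthogonal N, F t ∈ B.orthogonal N')
    (hFsim : ∀ u ∈ B.orthogonal N, ∀ v ∈ B.orthogonal N, B (F u) (F v) = r * B u v)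
    (hkey : ∀ v ∈ B.orthogonal N', (∀ t ∈ B.orthogonal N, B (F t) v = 0) → v = 0) :
    ∃ (m : ℕ) (a b : Fin m → V) (Ψ : V →ₗ[K] V), (∀ i, a i ∈ N) ∧ (∀ i, b i ∈ N') ∧
      (∀ x, Ψ x = F x + ∑ i, B x (a i) • b i) ∧ ∀ x y, B (Ψ x) (Ψ y) = r * B x y := by
  classical
  have h2 : (2 : K) ≠ 0 := NeZero.ne 2
  have hBr : B.IsRefl := hB.isRefl
  set T := B.orthogonal N with hTdef
  set T' := B.orthogonal N' with hT'def
  have hc : IsCompl N T :=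
    (LinearMap.BilinForm.restrict_nondegenerate_iff_isCompl_orthogonal hBr).1 hN
  have hc' : IsCompl N' T' :=
    (LinearMap.BilinForm.restrict_nondegenerate_iff_isCompl_orthogonal hBr).1 hN'
  have hTT : B.orthogonal T = N := LinearMap.BilinForm.orthogonal_orthogonal hBn hBr N
  have hTT' : B.orthogonal T' = N' := LinearMap.BilinForm.orthogonal_orthogonal hBn hBr N'
  -- `F|_T` is injective
  have hσinj : Function.Injective (F ∘ₗ T.subtype) := by
    rw [← LinearMap.ker_eq_bot, LinearMap.ker_eq_bot']
    rintro ⟨t, ht⟩ h0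
    rw [LinearMap.comp_apply, Submodule.subtype_apply] at h0
    have htN : t ∈ N := by
      rw [← hTT, LinearMap.BilinForm.mem_orthogonal_iff]
      intro v hv
      have h := hFsim v hv t ht
      rw [h0, map_zero] at h
      -- `h : 0 = r * B v t`... careful with the shape
      exact (mul_eq_zero.1 h.symm).resolve_left hr
    have : t = 0 := (Submodule.disjoint_def.1 hc.disjoint) t htN ht
    exact Subtype.ext this
  -- Witt along `M : (V, rB) ⥲ (V, B)`
  have hMinj : Function.Injective M := by
    rw [← LinearMap.ker_eq_bot, LinearMap.ker_eq_bot']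
    intro x hx
    refine hBn.1 x fun y => ?_
    have h := hM x y
    rw [hx, map_zero, LinearMap.zero_apply] at h
    exact (mul_eq_zero.1 h.symm).resolve_left hr
  let Me : V ≃ₗ[K] V := LinearEquiv.ofBijective M ⟨hMinj, LinearMap.injective_iff_surjective.1 hMinj⟩
  have hrB : (r • B).IsSymm := ⟨fun x y => by simp only [LinearMap.smul_apply, hB.eq x y]⟩
  have hrBn : (r • B).Nondegenerate := by
    refine ⟨fun x hx => hBn.1 x fun y => ?_, fun y hy => hBn.2 y fun x => ?_⟩
    · have h := hx y
      simp only [LinearMap.smul_apply, smul_eq_mul] at h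
      exact (mul_eq_zero.1 h).resolve_left hr
    · have h := hy x
      simp only [LinearMap.smul_apply, smul_eq_mul] at h
      exact (mul_eq_zero.1 h).resolve_left hr
  have hσB : ∀ x y : T, B ((F ∘ₗ T.subtype) x) ((F ∘ₗ T.subtype) y) = (r • B) x y := fun x y => by
    simp only [LinearMap.comp_apply, Submodule.subtype_apply, LinearMap.smul_apply, smul_eq_mul]
    exact hFsim x x.2 y y.2
  obtain ⟨τ, hτB, hτT⟩ := Witt_isometry_extension.exists_extension_of_equiv
    Witt_isometry_extension_holds h2 (r • B) B hrB hrBn Me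
    (fun x y => by
      show B (M x) (M y) = (r • B) x y
      rw [hM, LinearMap.smul_apply, LinearMap.smul_apply, smul_eq_mul])
    T (F ∘ₗ T.subtype) hσinj hσB
  have hτT' : ∀ t ∈ T, τ t = F t := fun t ht => by
    have h := hτT ⟨t, ht⟩
    rwa [LinearMap.comp_apply, Submodule.subtype_apply] at h
  have hτB' : ∀ x y, B (τ x) (τ y) = r * B x y := fun x y => by
    rw [hτB, LinearMap.smul_apply, LinearMap.smul_apply, smul_eq_mul]
  -- `τ` carries `N` into `N'`
  have hτN : ∀ u ∈ N, τ u ∈ N' := by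
    intro u hu
    obtain ⟨zN, hzN, zT, hzT, hz⟩ := Submodule.mem_sup.1
      (show τ u ∈ N' ⊔ T' by rw [hc'.sup_eq_top]; exact Submodule.mem_top)
    have hFz : ∀ t ∈ T, B (F t) (τ u) = 0 := fun t ht => by
      rw [← hτT' t ht, hτB', hB.eq, ht u hu, mul_zero]
    have hFzT : ∀ t ∈ T, B (F t) zT = 0 := fun t ht => by
      have h1 := hFz t ht
      rw [← hz, map_add] at h1
      have h2 : B (F t) zN = 0 := by rw [hB.eq]; exact hFT t ht zN hzN
      rwa [h2, zero_add] at h1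
    have hzT0 : zT = 0 := hkey zT hzT hFzT
    rw [← hz, hzT0, add_zero]
    exact hzN
  -- the correction `g = τ - F`
  set g : V →ₗ[K] V := τ.toLinearMap - F with hgdef
  have hgT : ∀ t ∈ T, g t = 0 := fun t ht => by
    rw [hgdef, LinearMap.sub_apply, LinearEquiv.coe_coe, hτT' t ht, sub_self]
  have hgN : ∀ x, g x ∈ N' := fun x => by
    obtain ⟨u, hu, t, ht, rfl⟩ := Submodule.mem_sup.1
      (show x ∈ N ⊔ T by rw [hc.sup_eq_top]; exact Submodule.mem_top)
    rw [map_add, hgT t ht, add_zero, hgdef, LinearMap.sub_apply, LinearEquiv.coe_coe]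
    exact N'.sub_mem (hτN u hu) (hFN u hu)
  obtain ⟨m, a, b, ha, hb, hg⟩ := exists_eq_sum_rankOne₂ hB hBn N N' g hgN hgT
  refine ⟨m, a, b, τ.toLinearMap, ha, hb, fun x => ?_, fun x y => ?_⟩
  · rw [← hg x, hgdef, LinearMap.sub_apply, LinearEquiv.coe_coe, add_sub_cancel]
  · rw [LinearEquiv.coe_coe, hτB']

end Field

/-! ### Marked projective K3 surfaces: the rational Néron–Severi points -/

section Marked

variable {S Sg : SchemeOver ℂ}

/-- **The rational Néron–Severi points of a marked projective K3 surface.** For a marking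
`η : H²(S(ℂ); ℂ) ≅ Λ_ℂ` (integral classes `↔ Λ`, `a ∪ b = (ηa.ηb) p₀`, `p₀ ≠ 0`) the rational
vectors `u ∈ Λ_ℚ` with `η⁻¹u ∈ N := algebraicClasses S 1` form a `ℚ`-subspace `N_ℚ` on which the
rational K3 form is NON-DEGENERATE (Hodge index: `eq_zero_of_mem_algebraicClasses_of_orthogonal`,
`N` being spanned by its rational classes), whose orthogonal `N_ℚ^⊥` consists exactly of the
rational vectors `u` with `η⁻¹u` transcendental (`η⁻¹u ∪ d = 0` for all `d ∈ N`), and a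
transcendental class is K3-orthogonal to (the images of) all of `N_ℚ`.
[cite: Huybrechts2016K3, Ch. 3 §2.2 and Lemma 3.3.1] [cite: Hartshorne1977, V Thm. 1.9] -/
theorem exists_nsRat (hS : IsK3Surface S) (hHI : hodgeIndex_surface S)
    (η : complexBetti S (2 * 1) ≃ₗ[ℂ] (K3Index → ℂ)) {p₀ : complexBetti S (2 * 2)} (hp₀ : p₀ ≠ 0)
    (hηint : ∀ c : complexBetti S (2 * 1), IsIntegralClass c ↔ ∃ v : K3Index → ℤ, η c = fun i => (v i : ℂ))
    (hηcup : ∀ a b : complexBetti S (2 * 1),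
      cupProduct (rfl : 2 * 1 + 2 * 1 = 2 * 2) a b = k3Form (η a) (η b) • p₀) :
    ∃ NQ : Submodule ℚ (K3Index → ℚ),
      (∀ u, u ∈ NQ ↔ η.symm (fun j => (u j : ℂ)) ∈ algebraicClasses S 1) ∧
      (k3FormRat.restrict NQ).Nondegenerate ∧
      (∀ u ∈ k3FormRat.orthogonal NQ, ∀ d ∈ algebraicClasses S 1,
        cupProduct (rfl : 2 * 1 + 2 * 1 = 2 * 2) (η.symm fun j => (u j : ℂ)) d = 0) ∧
      (∀ x : complexBetti S (2 * 1),
        (∀ d ∈ algebraicClasses S 1, cupProduct (rfl : 2 * 1 + 2 * 1 = 2 * 2) x d = 0) →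
          ∀ w ∈ NQ, k3Form (fun j => (w j : ℂ)) (η x) = 0) ∧
      (∀ u : K3Index → ℚ,
        (∀ d ∈ algebraicClasses S 1,
            cupProduct (rfl : 2 * 1 + 2 * 1 = 2 * 2) (η.symm fun j => (u j : ℂ)) d = 0) →
          u ∈ k3FormRat.orthogonal NQ) := by
  classical
  set N := algebraicClasses S 1 with hNdef
  let NQ : Submodule ℚ (K3Index → ℚ) :=
    { carrier := {u | η.symm (fun j => (u j : ℂ)) ∈ N}
      add_mem' := fun {u v} hu hv => by
        simp only [Set.mem_setOf_eq, ratCastΛ_add, map_add]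
        exact N.add_mem hu hv
      zero_mem' := by
        simp only [Set.mem_setOf_eq, ratCastΛ_zero, map_zero]
        exact N.zero_mem
      smul_mem' := fun q u hu => by
        simp only [Set.mem_setOf_eq, ratCastΛ_smul, map_smul]
        exact N.smul_mem _ hu }
  have memNQ : ∀ u, u ∈ NQ ↔ η.symm (fun j => (u j : ℂ)) ∈ N := fun u => Iff.rfl
  -- `N` is spanned by its rational classes, so `N_ℚ^⊥ ⊗ ℂ ⊆ N^⊥`
  have hspan := span_isRationalClass_eq_top_of_isSmoothProjective_holds.supportedClasses_eq_span
    hS.isSmoothProjective (2 * 1) 1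
  have horth : ∀ u ∈ k3FormRat.orthogonal NQ, ∀ d ∈ N, k3Form (fun j => (u j : ℂ)) (η d) = 0 := by
    intro u hu d hd
    rw [LinearMap.BilinForm.mem_orthogonal_iff] at hu
    have hd' : d ∈ Submodule.span ℂ {c : complexBetti S (2 * 1) |
        IsRationalClass c ∧ c ∈ supportedClasses S (2 * 1) 1} := by
      rw [← hspan]; exact hd
    clear hd
    induction hd' using Submodule.span_induction with
    | mem d hd =>
      obtain ⟨w, hw⟩ := (isRationalClass_iff_of_marking hS η hηint d).1 hd.1
      have hwN : w ∈ NQ := by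
        rw [memNQ, ← hw, LinearEquiv.symm_apply_apply]
        exact hd.2
      rw [hw, k3Form_ratCast, k3FormRat_isSymm.eq, hu w hwN, Rat.cast_zero]
    | zero => rw [map_zero, k3Form_zero_right]
    | add c c' _ _ hc hc' => rw [map_add, k3Form_add_right, hc, hc', add_zero]
    | smul t c _ hc => rw [map_smul, k3Form_smul_right, hc, mul_zero]
  -- a transcendental class is orthogonal to `N_ℚ`
  have hperp : ∀ x : complexBetti S (2 * 1),
      (∀ d ∈ N, cupProduct (rfl : 2 * 1 + 2 * 1 = 2 * 2) x d = 0) →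
        ∀ w ∈ NQ, k3Form (fun j => (w j : ℂ)) (η x) = 0 := by
    intro x hx w hw
    have h := hx _ ((memNQ w).1 hw)
    rw [hηcup, LinearEquiv.apply_symm_apply, smul_eq_zero, or_iff_left hp₀] at h
    rwa [k3Form_comm] at h
  -- the form is non-degenerate on `N_ℚ` (Hodge index)
  have hNQ : (k3FormRat.restrict NQ).Nondegenerate := by
    refine LinearMap.BilinForm.Nondegenerate.ofSeparatingLeft ?_
    rintro ⟨u, hu⟩ h
    have huT : u ∈ k3FormRat.orthogonal NQ := by
      rw [LinearMap.BilinForm.mem_orthogonal_iff]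
      intro w hw
      rw [k3FormRat_isSymm.eq]
      exact h ⟨w, hw⟩
    have hd0 : η.symm (fun j => (u j : ℂ)) = 0 := by
      refine eq_zero_of_mem_algebraicClasses_of_orthogonal hS hHI ((memNQ u).1 hu)
        ((isRationalClass_iff_of_marking hS η hηint _).2 ⟨u, η.apply_symm_apply _⟩) fun d hd => ?_
      rw [hηcup, LinearEquiv.apply_symm_apply, horth u huT d hd, zero_smul]
    have hu0 : (fun j => (u j : ℂ)) = 0 := by simpa using congrArg η hd0
    exact Subtype.ext (ratCastΛ_injective (hu0.trans ratCastΛ_zero.symm))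
  refine ⟨NQ, memNQ, hNQ, fun u hu d hd => ?_, hperp, fun u hu => ?_⟩
  · rw [hηcup, LinearEquiv.apply_symm_apply, horth u hu d hd, zero_smul]
  · rw [LinearMap.BilinForm.mem_orthogonal_iff]
    intro w hw
    apply Rat.cast_injective (α := ℂ)
    rw [← k3Form_ratCast, Rat.cast_zero]
    have h := hperp _ hu w hw
    rwa [LinearEquiv.apply_symm_apply] at h

/-- **A rational `(1,1)`-preserving map sends `NS(S)` into `NS(Sg)`** (projective K3 surfaces,
GRANTED Lefschetz `(1,1)` on the target and `NS ⊆ H^{1,1}` on the source): `NS(S) = N¹H²` is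
spanned by its rational classes, whose images are rational of type `(1,1)`, hence algebraic.
Two-surface form of `map_mem_algebraicClasses_of_hodgeEndo`. [cite: VoisinHodgeI2002, §11.3 (Thm. 11.30)] -/
theorem map_mem_algebraicClasses_of_hodgeMap (hS : IsK3Surface S) (hSg : IsK3Surface Sg)
    (hL : LefschetzOneOneK3) (hN : AlgebraicClassesOneOneK3)
    (Φ : complexBetti S (2 * 1) →ₗ[ℂ] complexBetti Sg (2 * 1))
    (hΦrat : ∀ x, IsRationalClass x → IsRationalClass (Φ x))
    (hΦtype : ∀ x, IsOfHodgeType 2 S (2 * 1) 1 1 x → IsOfHodgeType 2 Sg (2 * 1) 1 1 (Φ x))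
    {d : complexBetti S (2 * 1)} (hd : d ∈ algebraicClasses S 1) : Φ d ∈ algebraicClasses Sg 1 := by
  have hspan := span_isRationalClass_eq_top_of_isSmoothProjective_holds.supportedClasses_eq_span
    hS.isSmoothProjective (2 * 1) 1
  have hd' : d ∈ Submodule.span ℂ {c : complexBetti S (2 * 1) |
      IsRationalClass c ∧ c ∈ supportedClasses S (2 * 1) 1} := by
    rw [← hspan]; exact hd
  clear hd
  induction hd' using Submodule.span_induction with
  | mem c hc => exact hL Sg hSg _ (hΦrat c hc.1) (hΦtype c (hN S hS c hc.2))
  | zero => rw [map_zero]; exact Submodule.zero_mem _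
  | add c c' _ _ hc hc' => rw [map_add]; exact Submodule.add_mem _ hc hc'
  | smul t c _ hc => rw [map_smul]; exact Submodule.smul_mem _ _ hc

/-- **`Φ + Σᵢ νᵢ` preserves every Hodge type** (projective K3 surfaces `S`, `Sg`; `σ ≠ 0` a
`(2,0)`-class of `S`): if `Φ` preserves Hodge types, every `νᵢ` kills `σ` and `σ̄` and takes only
values of type `(1,1)`, then `Φ + Σᵢ νᵢ` preserves Hodge types — the `(2,0)`- and `(0,2)`-classes
are the lines `ℂσ`, `ℂσ̄` (`Huybrechts_K3_hodgeTypes_H2_holds`), type `(1,1)` is closed under sums,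
and the bidegrees `i + j ≠ 2` carry only `0`. Two-surface form of `isOfHodgeType_add_correction'`.
[cite: Huybrechts2016K3, Ch. 6 Prop. 1.2] [cite: VoisinHodgeI2002, §7.1.1] -/
theorem isOfHodgeType_add_sum (hS : IsK3Surface S) (hSg : IsK3Surface Sg)
    {σ : complexBetti S (2 * 1)} (h20 : IsOfHodgeType 2 S (2 * 1) 2 0 σ) (hσ0 : σ ≠ 0)
    (Φ : complexBetti S (2 * 1) →ₗ[ℂ] complexBetti Sg (2 * 1))
    (hΦtype : ∀ (i j : ℕ) x, IsOfHodgeType 2 S (2 * 1) i j x → IsOfHodgeType 2 Sg (2 * 1) i j (Φ x))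
    {m : ℕ} (ν : Fin m → (complexBetti S (2 * 1) →ₗ[ℂ] complexBetti Sg (2 * 1)))
    (hνσ : ∀ i, ν i σ = 0) (hνσ' : ∀ i, ν i (conjClass (ComplexPoints S) (2 * 1) σ) = 0)
    (hν11 : ∀ i x, IsOfHodgeType 2 Sg (2 * 1) 1 1 (ν i x)) :
    ∀ (i j : ℕ) (x : complexBetti S (2 * 1)), IsOfHodgeType 2 S (2 * 1) i j x →
      IsOfHodgeType 2 Sg (2 * 1) i j ((Φ + ∑ i, ν i) x) := by
  obtain ⟨h1, h2, -⟩ := Huybrechts_K3_hodgeTypes_H2_holds S hS σ h20 hσ0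
  obtain ⟨A'⟩ := hSg.nonempty_hodgeModel
  have hSg' := hSg.isSmoothProjective
  intro i j x hx
  by_cases hij : i + j = 2 * 1
  · obtain ⟨rfl, rfl⟩ | ⟨rfl, rfl⟩ | ⟨rfl, rfl⟩ :
        (i = 2 ∧ j = 0) ∨ (i = 0 ∧ j = 2) ∨ (i = 1 ∧ j = 1) := by omega
    · obtain ⟨t, rfl⟩ := (h1 x).1 hx
      have h0 : (∑ i, ν i) (t • σ) = 0 := by
        rw [LinearMap.sum_apply]
        exact Finset.sum_eq_zero fun k _ => by rw [map_smul, hνσ k, smul_zero]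
      rw [LinearMap.add_apply, h0, add_zero]
      exact hΦtype 2 0 _ hx
    · obtain ⟨t, rfl⟩ := (h2 x).1 hx
      have h0 : (∑ i, ν i) (t • conjClass (ComplexPoints S) (2 * 1) σ) = 0 := by
        rw [LinearMap.sum_apply]
        exact Finset.sum_eq_zero fun k _ => by rw [map_smul, hνσ' k, smul_zero]
      rw [LinearMap.add_apply, h0, add_zero]
      exact hΦtype 0 2 _ hx
    · rw [LinearMap.add_apply, LinearMap.sum_apply]
      exact (hΦtype 1 1 x hx).add hSg' (IsOfHodgeType.sum hSg' A' Finset.univ _ fun k _ => hν11 k x)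
  · obtain rfl := isOfHodgeType_eq_zero_of_add_ne hx hij
    rw [map_zero]
    exact IsOfHodgeType.zero A' _ _ _

end Marked

end Summit.HodgeConjecture.HodgeConjecture.Theorems.NikulinTwinTransport

end
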